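import Summits.AtomisticToContinuum.BoseEinsteinCondensation.Theorems.PeriodicIRBound.Negative.FreeGas
import Literature.Barriers.AtomisticToContinuum.KineticGapLengthScalesScaling

/-!
# Negative lemmas for crux `PeriodicIRBound` (stmt-AtomisticToContinuum-3972), V: scaling covariance

Supports (does not close) stmt-AtomisticToContinuum-3972, route `BECGroundStateSOS`. Landed copy of
§13 of `Cruxes/PeriodicIRBound/Disproof.lean` (cycle 1); all `sorry`-free.

* `cellOccupation_planeWaveMode_dilate` — plane-wave occupations are invariant under the dilation
  `Ψ = b^{-3N/2}Φ(·/b)` of `KineticGapLengthScalesScaling` (`planeWaveMode_dilate`).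
* `irBoundWith_scaledPotential` — if `v` satisfies the crux's bound with data `(κ, ρ₀, C)` then
  `b⁻²v(·/b)` satisfies it with `(κ√b, ρ₀/b³, C√b)`; `irBoundFor_scaledPotential`: `IRBoundFor` is
  dilation invariant per potential. WLOG unit range; `C` has dimension `length^{1/2}` (`∼ √a`).
-/

noncomputable section

open MeasureTheory Filter
open scoped ENNReal NNReal ComplexConjugate BigOperators
namespace Summit.AtomisticToContinuum.BoseEinsteinCondensation.Theorems.PeriodicIRBound.Negative

open Literature.MathematicalPhysics.QuantumManyBody.BoseGas
open Summit.AtomisticToContinuum.BoseEinsteinCondensation.Theses.BECGroundStateSOS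
open Summit.AtomisticToContinuum.BoseEinsteinCondensation.Theorems.GaussianDominationCan.Negative
  (symState symFun oneBody periodicEnergy_symState nsq nsq_nonneg e0 e0_ne_zero norm_e0
    nsq_e0 one_le_norm_intVec lintegral_nnnorm_sq_prodFun lintegral_nnnorm_sq_oneBody
    continuous_oneBody integral_cell_const conj_cellWave_mul_self integral_cell_conj_cellWave
    isRepulsiveFiniteRange_zero)
open Summit.AtomisticToContinuum.BoseEinsteinCondensation.Theorems.GaussianDominationCan.Negative
  renaming prodFun → gdProd
open Summit.AtomisticToContinuum.BoseEinsteinCondensation.Theorems.CorrectorClosure.Negative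
  (hardCore isRepulsiveFiniteRange_hardCore periodicEnergy_hardCore_eq_top
    periodicGroundStateEnergy_one_eq_top)

variable {L : ℝ} {m : ℕ} {n : Fin 3 → ℤ} {a b : ℝ}

/-! ## §13 SCALING COVARIANCE `v ↦ b⁻² v(·/b)`: WLOG unit range; `C` has the dimension of `√a` -/

section Scaling

open Literature.Barriers.AtomisticToContinuum.BoseGas (scaledPotential dilateConst dilateConst_pos
  dilateConst_sq_mul setIntegral_cell_comp_inv_smul setLIntegral_cellN_comp_inv_smul nnnorm_real_mul_sq
  periodicEnergy_dilate periodicGroundStateEnergy_scaledPotential isRepulsiveFiniteRange_scaledPotential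
  scaledPotential_scaledPotential_inv)

variable {N : ℕ}

/-- Plane waves dilate: `φ_k^{bM}(x) = b^{-3/2} φ_k^{M}(x/b)`. [folklore] -/
theorem planeWaveMode_dilate {b : ℝ} (hb : 0 < b) (M : ℝ) (k : Fin 3 → ℤ) (x : Space) :
    planeWaveMode (b * M) k x = ((Real.sqrt (b ^ 3))⁻¹ : ℂ) * planeWaveMode M k (b⁻¹ • x) := by
  rw [planeWaveMode_eq, planeWaveMode_eq, cellWave_apply, cellWave_apply]
  have hsum : (∑ j, (k j : ℝ) * (b⁻¹ • x) j) = b⁻¹ * ∑ j, (k j : ℝ) * x j := by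
    rw [Finset.mul_sum]
    refine Finset.sum_congr rfl fun j _ => ?_
    rw [PiLp.smul_apply, smul_eq_mul]
    ring
  have hexp : Complex.exp (2 * Real.pi * Complex.I * ((∑ j, (k j : ℝ) * x j : ℝ) : ℂ) / ((b * M : ℝ) : ℂ)) =
      Complex.exp (2 * Real.pi * Complex.I * ((∑ j, (k j : ℝ) * (b⁻¹ • x) j : ℝ) : ℂ) / (M : ℂ)) := by
    rw [hsum]
    rcases eq_or_ne M 0 with hM | hM
    · subst hM; simp
    · congr 1
      have hb' : (b : ℂ) ≠ 0 := Complex.ofReal_ne_zero.2 hb.ne'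
      have hM' : (M : ℂ) ≠ 0 := Complex.ofReal_ne_zero.2 hM
      push_cast
      field_simp
  have hsqrt : Real.sqrt ((b * M) ^ 3) = Real.sqrt (b ^ 3) * Real.sqrt (M ^ 3) := by
    rw [mul_pow, Real.sqrt_mul (by positivity)]
  rw [hexp, hsqrt]
  push_cast
  ring

/-- **Occupations of plane waves are dilation invariant**: `n_k(b^{-3N/2}Φ(·/b)) = n_k(Φ)` (mode `k`
of the big torus is the dilated mode `k`). [folklore] -/
theorem cellOccupation_planeWaveMode_dilate {M M' b : ℝ} (hb : 0 < b) (hM : M' = b * M)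
    (Φ : PeriodicTrialState N M) (k : Fin 3 → ℤ) :
    cellOccupation N M' (planeWaveMode M' k) (Φ.dilate b hb hM).ψ =
      cellOccupation N M (planeWaveMode M k) Φ.ψ := by
  subst hM
  cases N with
  | zero => simp [cellOccupation, occupation]
  | succ n =>
    rw [cellOccupation_succ, cellOccupation_succ]
    congr 1
    have hb3 : 0 < b ^ 3 := pow_pos hb 3
    have hs0 : ((Real.sqrt (b ^ 3) : ℝ) : ℂ) ≠ 0 :=
      Complex.ofReal_ne_zero.2 (Real.sqrt_pos.2 hb3).ne'
    have hsq : ((b : ℂ)) ^ 3 = ((Real.sqrt (b ^ 3) : ℝ) : ℂ) * ((Real.sqrt (b ^ 3) : ℝ) : ℂ) := by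
      exact_mod_cast (Real.mul_self_sqrt hb3.le).symm
    set c : ℝ := dilateConst b (n + 1) * Real.sqrt (b ^ 3) with hc
    have hinner : ∀ Y : Config n,
        ∫ x in cell (b * M), conj (planeWaveMode (b * M) k x) *
            (Φ.dilate b hb rfl).ψ (Matrix.vecCons x Y) =
          (c : ℂ) * ∫ x in cell M, conj (planeWaveMode M k x) * Φ.ψ (Matrix.vecCons x (b⁻¹ • Y)) := by
      intro Y
      have hpt : ∀ x : Space, conj (planeWaveMode (b * M) k x) *
          (Φ.dilate b hb rfl).ψ (Matrix.vecCons x Y) =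
          ((dilateConst b (n + 1) * (Real.sqrt (b ^ 3))⁻¹ : ℝ) : ℂ) *
            (fun y => conj (planeWaveMode M k y) * Φ.ψ (Matrix.vecCons y (b⁻¹ • Y))) (b⁻¹ • x) := by
        intro x
        rw [PeriodicTrialState.dilate_ψ, Matrix.smul_cons, planeWaveMode_dilate hb M k x, map_mul]
        have : conj (((Real.sqrt (b ^ 3))⁻¹ : ℂ)) = ((Real.sqrt (b ^ 3))⁻¹ : ℂ) := by
          rw [← Complex.ofReal_inv, Complex.conj_ofReal]
        rw [this]
        push_cast
        ring
      simp_rw [hpt]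
      rw [integral_const_mul, setIntegral_cell_comp_inv_smul hb M
        (fun y => conj (planeWaveMode M k y) * Φ.ψ (Matrix.vecCons y (b⁻¹ • Y))), ← mul_assoc]
      congr 1
      rw [hc]
      push_cast
      rw [hsq]
      field_simp
    simp_rw [hinner]
    have hc0 : 0 ≤ c := mul_nonneg (dilateConst_pos hb (n + 1)).le (Real.sqrt_nonneg _)
    simp_rw [nnnorm_real_mul_sq hc0]
    rw [lintegral_const_mul' _ _ ENNReal.ofReal_ne_top,
      setLIntegral_cellN_comp_inv_smul hb M
        (fun Y => ((‖∫ x in cell M, conj (planeWaveMode M k x) * Φ.ψ (Matrix.vecCons x Y)‖₊ : ℝ≥0∞)) ^ 2),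
      ← mul_assoc]
    have hconst : ENNReal.ofReal (c ^ 2) * ENNReal.ofReal ((b ^ 3) ^ n) = 1 := by
      rw [← ENNReal.ofReal_mul (sq_nonneg _), ← ENNReal.ofReal_one]
      congr 1
      have h1 := dilateConst_sq_mul hb (n + 1)
      rw [hc, mul_pow, Real.sq_sqrt hb3.le, mul_assoc, ← pow_succ', h1]
    rw [hconst, one_mul]

/-- `L_N(ρ/b³) = b · L_N(ρ)`. [folklore] -/
theorem sideLength_div_cube {ρ b : ℝ} (hρ : 0 < ρ) (hb : 0 < b) (N : ℕ) :
    sideLength (ρ / b ^ 3) N = b * sideLength ρ N := by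
  unfold sideLength
  rw [div_div_eq_mul_div, mul_comm (N : ℝ), mul_div_assoc,
    Real.mul_rpow (by positivity) (by positivity)]
  congr 1
  rw [show ((1 : ℝ) / 3) = ((3 : ℕ) : ℝ)⁻¹ by norm_num, Real.pow_rpow_inv_natCast hb.le three_ne_zero]

/-- `√b · √(ρ/b³) · (b L) = √ρ · L`. [folklore] -/
theorem sqrt_mul_sqrt_div_cube {ρ b : ℝ} (hρ : 0 ≤ ρ) (hb : 0 < b) (L : ℝ) :
    Real.sqrt b * Real.sqrt (ρ / b ^ 3) * (b * L) = Real.sqrt ρ * L := by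
  have h3 : Real.sqrt (b ^ 3) = b * Real.sqrt b := by
    rw [show b ^ 3 = b ^ 2 * b by ring, Real.sqrt_mul (sq_nonneg b), Real.sqrt_sq hb.le]
  rw [Real.sqrt_div hρ, h3]
  have hsb : Real.sqrt b ≠ 0 := (Real.sqrt_pos.2 hb).ne'
  field_simp

/-- **Scaling covariance of the crux, per potential.** If `v` satisfies the bound with data
`(κ, ρ₀, C)` then `b⁻²v(·/b)` (range `bR₀`, scattering length `b·a`) satisfies it with data
`(κ√b, ρ₀/b³, C√b)`: dilate a near-minimiser of the scaled problem on `L_N(ρ/b³) = bL_N(ρ)` back to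
`L_N(ρ)` (energies scale by `b²` EXACTLY, `periodicGroundStateEnergy_scaledPotential`; occupations are
invariant, `cellOccupation_planeWaveMode_dilate`; windows and bounds coincide). So WLOG the range is
`1`, and the constant carries the dimension `length^{1/2}` — consistent with `C ∼ √a` and with
nothing else: no dimensionless (v-independent) constant can be read off the crux. [folklore] -/
theorem irBoundWith_scaledPotential {v : ℝ → ℝ≥0∞} {κ ρ₀ C b : ℝ} (hb : 0 < b)
    (h : IRBoundWith v κ ρ₀ C) :
    IRBoundWith (scaledPotential v b) (κ * Real.sqrt b) (ρ₀ / b ^ 3) (C * Real.sqrt b) := by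
  intro ρ' hρ' hρ'lt
  have hb3 : 0 < b ^ 3 := pow_pos hb 3
  set ρ : ℝ := b ^ 3 * ρ' with hρdef
  have hρ : 0 < ρ := mul_pos hb3 hρ'
  have hρρ₀ : ρ < ρ₀ := by
    rw [lt_div_iff₀ hb3] at hρ'lt
    linarith [mul_comm ρ' (b ^ 3)]
  have hρ'eq : ρ' = ρ / b ^ 3 := by
    rw [hρdef]; field_simp
  filter_upwards [h ρ hρ hρρ₀, eventually_gt_atTop 0] with N ⟨δ, hδ, hN⟩ hNpos
  have hL := sideLength_pos_of_pos hρ hNpos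
  have hL' : sideLength ρ' N = b * sideLength ρ N := by
    rw [hρ'eq]; exact sideLength_div_cube hρ hb N
  have hM : sideLength ρ N = b⁻¹ * sideLength ρ' N := by
    rw [hL', inv_mul_cancel_left₀ hb.ne']
  set B : ℝ≥0∞ := ENNReal.ofReal (b ^ 2) with hB
  have hB0 : B ≠ 0 := by rw [hB]; simpa using hb.ne'
  have hBtop : B ≠ ⊤ := ENNReal.ofReal_ne_top
  refine ⟨B⁻¹ * δ, ENNReal.mul_pos (ENNReal.inv_ne_zero.2 hBtop) hδ.ne', fun Ψ hΨ k hk => ?_⟩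
  -- pull the state back to the torus of side `L_N(ρ)`
  set Φ : PeriodicTrialState N (sideLength ρ N) := Ψ.dilate b⁻¹ (inv_pos.2 hb) hM with hΦdef
  have hE : periodicEnergy v Φ = B * periodicEnergy (scaledPotential v b) Ψ := by
    have := periodicEnergy_dilate (inv_pos.2 hb) hM (scaledPotential v b) Ψ
    rw [scaledPotential_scaledPotential_inv hb] at this
    rw [hΦdef, this, hB, inv_pow, ENNReal.ofReal_inv_of_pos (by positivity), inv_inv]
  have hE0 : periodicGroundStateEnergy (scaledPotential v b) N (sideLength ρ' N) =
      B⁻¹ * periodicGroundStateEnergy v N (sideLength ρ N) := by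
    rw [hL']; exact periodicGroundStateEnergy_scaledPotential hb v N
  have hΦ : NearMin v ρ N δ Φ := by
    unfold NearMin at hΨ ⊢
    rw [hE0, ← mul_add] at hΨ
    rw [hE]
    calc B * periodicEnergy (scaledPotential v b) Ψ
        ≤ B * (B⁻¹ * (periodicGroundStateEnergy v N (sideLength ρ N) + δ)) := mul_le_mul_right hΨ _
      _ = periodicGroundStateEnergy v N (sideLength ρ N) + δ := by
          rw [← mul_assoc, ENNReal.mul_inv_cancel hB0 hBtop, one_mul]
  -- the windows coincide
  have hid : Real.sqrt b * Real.sqrt ρ' * sideLength ρ' N = Real.sqrt ρ * sideLength ρ N := by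
    rw [hL', hρ'eq]
    exact sqrt_mul_sqrt_div_cube hρ.le hb (sideLength ρ N)
  have hwin : InWindow κ ρ N k := by
    refine ⟨hk.1, ?_⟩
    calc ‖(fun j => (k j : ℝ))‖ ≤ κ * Real.sqrt b * Real.sqrt ρ' * sideLength ρ' N := hk.2
      _ = κ * (Real.sqrt b * Real.sqrt ρ' * sideLength ρ' N) := by ring
      _ = κ * Real.sqrt ρ * sideLength ρ N := by rw [hid]; ring
  have key := hN Φ hΦ k hwin
  rw [irIneq_iff] at key ⊢
  rw [hΦdef, cellOccupation_planeWaveMode_dilate (inv_pos.2 hb) hM Ψ k] at key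
  refine key.trans_eq ?_
  congr 1
  calc C * Real.sqrt ρ * sideLength ρ N / ‖(fun j => (k j : ℝ))‖
      = C * (Real.sqrt b * Real.sqrt ρ' * sideLength ρ' N) / ‖(fun j => (k j : ℝ))‖ := by rw [hid]; ring
    _ = C * Real.sqrt b * Real.sqrt ρ' * sideLength ρ' N / ‖(fun j => (k j : ℝ))‖ := by ring

/-- Hence `IRBoundFor v → IRBoundFor (b⁻²v(·/b))` for every `b > 0` (and back, by `b⁻¹`): the crux
is dilation invariant potential by potential. [folklore] -/
theorem irBoundFor_scaledPotential {v : ℝ → ℝ≥0∞} {b : ℝ} (hb : 0 < b) (h : IRBoundFor v) :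
    IRBoundFor (scaledPotential v b) := by
  intro κ hκ
  obtain ⟨ρ₀, hρ₀, C, hC, h⟩ := h (κ / Real.sqrt b) (by positivity)
  refine ⟨ρ₀ / b ^ 3, by positivity, C * Real.sqrt b, by positivity, ?_⟩
  have := irBoundWith_scaledPotential hb h
  rwa [div_mul_cancel₀ κ (Real.sqrt_pos.2 hb).ne'] at this

end Scaling

end Summit.AtomisticToContinuum.BoseEinsteinCondensation.Theorems.PeriodicIRBound.Negative

end
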